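import Mathlib.Analysis.Matrix.Spectrum
import Literature.Analysis.Matrix.KroneckerSumExp
import Literature.Analysis.Matrix.DirichletSecondDifferenceEigen
import Literature.LinearAlgebra.Matrix.CirculantDFT
import Literature.Analysis.SpecialFunctions.CircleLaplacianDeterminant
import HarnessLib

/-!
# The determinant of a Kronecker sum, and the periodic second-difference («time-circle») factor

Topic `Literature/Analysis/Matrix`; namespace `Literature.Analysis.Matrix.KroneckerSumDeterminant`.  Everything here is
PROVED; no definitions (the Kronecker sum `kroneckerSum A B = A ⊗ 1 + 1 ⊗ B` is `KroneckerSumExp.lean`'s,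
[Bernstein2009, Def. 7.2.1]); no named facts.

RESULTS.
* §1 (any commutative ring) `diagonal_kroneckerSum_eq_reindex_blockDiagonal` (`diag(d) ⊕ T` is block diagonal with
  blocks `d_i·1 + T`), ★ `det_kroneckerSum_diagonal` (`det(diag(d) ⊕ T) = ∏_i det(d_i·1 + T)`), `kroneckerSum_conj`
  ∕ `det_kroneckerSum_conj` (conjugating the first summand by `C` with `C C' = 1` conjugates the sum by `C ⊗ 1`
  and does not change the determinant).
* §2 (`𝕜 = ℝ` or `ℂ`) ★★ `det_kroneckerSum_of_isHermitian` — **`det(S ⊗ 1 + 1 ⊗ T) = ∏_{λ ∈ spec S} det(λ·1 + T)`** for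
  `S` Hermitian (unitary diagonalisation), `det_smul_one_add_of_isHermitian` (`det(c·1 + T) = ∏_μ (c + μ)`), and the
  determinant form of [Bernstein2009, Prop. 7.2.3 (7.2.3)] `det(S ⊕ T) = ∏_{λ,μ} (λ + μ)`
  (`det_kroneckerSum_of_isHermitian_of_isHermitian`).
* §3 the time-circle factor: the periodic second difference `Δ_N = circulant (cycleLapVec)` (`(Δx)_i = 2x_i − x_{i+1}
  − x_{i−1}` on `Fin N`, the Laplacian of the `N`-cycle; `CirculantDFT.lean`) has ★ `det_smul_one_add_cycleLaplacian`:
  `det(z·1 + Δ_{n+1}) = ∏_{k} (z + (2 − 2cos(2πk/(n+1))))` over `ℂ` (DFT diagonalisation of circulants,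
  [GolubVanLoan2013, Thm 4.8.2]; eigenvalues [BrouwerHaemers2012, §1.4.3]), `cycleLapEig_eq_four_sin_sq`
  (`= 4 sin²(πk/N)`), the REAL form ★ `det_smul_one_add_cycleLaplacian_real`
  (`det_ℝ(λ·1 + Δ_{n+1}) = ∏_{q<n+1} (λ + 4 sin²(πq/(n+1)))`), its closed form `det_smul_one_add_cycleLaplacian_eq_sinh_sq`
  (`= 4 sinh²((n+1)ω/2)`, `cosh ω = 1 + λ/2`, `λ ≥ 0`; `CircleLaplacianDeterminant.prod_add_four_sin_sq_of_nonneg`), and the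
  assembled ★★ `det_kroneckerSum_cycleLaplacian_of_isHermitian`:
  `det_ℝ(S ⊗ 1 + 1 ⊗ Δ_{n+1}) = ∏_{λ ∈ spec S} ∏_{q<n+1} (λ + 4 sin²(πq/(n+1)))` for a real symmetric `S`.
* §4 doubling the time circle: `four_sinh_sq_half` (`4 sinh²(y/2) = 2cosh y − 2`), `sq_four_sinh_sq_div`,
  `det_smul_one_add_cycleLaplacian_eq_two_cosh_sub` (`det(λ·1 + Δ_t) = 2cosh(tω) − 2`), ★
  `det_smul_one_add_cycleLaplacian_sq_div` (`det(λ·1 + Δ_t)² / det(λ·1 + Δ_{2t}) = tanh²(tω/2)`, `λ ≥ 0`) and ★★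
  `det_kroneckerSum_cycleLaplacian_sq_div` (`det(S ⊕ Δ_t)² / det(S ⊕ Δ_{2t}) = ∏_i tanh²(tω_i/2)`, `S` positive semidefinite).

WHY (the use; cell `ym-ir`, row 43, «THE NUMBER»).  The Gaussian determinant of a slab Hessian `Δ₀ ⊗ 1 + 1 ⊗ Δ_t`
(spatial operator ⊕ free time-circle) factorises over the spectrum of `Δ₀`, each factor being `2cosh(tω_λ) − 2`; the
ratio over two time extents `t` and `2t` is then `∏_λ tanh²(tω_λ/2)`-type — the bookkeeping asked for by the LEAD of
row 43 (W-N4).  Honest scope: finite-dimensional linear algebra; nothing here bears on the Yang–Mills mass gap (Clay),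
which is NOT proved; `R4` closes only the conditional finite-`𝕋⁴` rung `BalabanLadder.UV`.

## References
* D. S. Bernstein, *Matrix Mathematics* (2nd ed., 2009), Def. 7.2.1 (7.2.1) and Prop. 7.2.3 (7.2.3) (PDF p. 430:
  `mspec(A ⊕ B) = {λ + μ}`). [Bernstein2009]
* G. H. Golub, C. F. Van Loan, *Matrix Computations* (4th ed., 2013), Thm 4.8.2 (circulants are diagonalised by the
  DFT). [GolubVanLoan2013]
* A. E. Brouwer, W. H. Haemers, *Spectra of Graphs* (2012), §1.4.3 (the cycle: Laplace eigenvalues `2 − 2cos(2πk/n)`).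
  [BrouwerHaemers2012]
-/

noncomputable section

open scoped Kronecker
open _root_.Matrix Finset
open Literature.Analysis.Matrix.KroneckerSum (kroneckerSum)
open Literature.LinearAlgebra.Matrix (cycleLapVec cycleAdjVec circulantEig circulantEig_add circulantEig_single
  circulantEig_cycleLapVec det_circulant_eq_prod_circulantEig)
open Literature.Combinatorics.SimpleGraph (cycleLapEig cycleAngle)

namespace Literature.Analysis.Matrix.KroneckerSumDeterminant

variable {m n : Type*} [Fintype m] [DecidableEq m] [Fintype n] [DecidableEq n]

/-! ## §1 Over a commutative ring: the diagonal case and conjugation -/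

section CommRing

variable {R : Type*} [CommRing R]

omit [Fintype m] [Fintype n] in
/-- **`diag(d) ⊕ T` is block diagonal**: after swapping the order of the product index,
`diag(d) ⊗ 1 + 1 ⊗ T = blockDiagonal (i ↦ d_i·1 + T)`. [cite: Bernstein2009, Def. 7.2.1 (7.2.1) and Prop. 7.2.3] -/
theorem diagonal_kroneckerSum_eq_reindex_blockDiagonal (d : m → R) (T : Matrix n n R) :
    kroneckerSum (diagonal d) T =
      Matrix.reindex (Equiv.prodComm n m) (Equiv.prodComm n m)
        (blockDiagonal fun i : m => d i • (1 : Matrix n n R) + T) := by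
  ext ⟨i, a⟩ ⟨j, b⟩
  simp only [kroneckerSum, Matrix.add_apply, kroneckerMap_apply, reindex_apply, submatrix_apply,
    Equiv.prodComm_symm, Equiv.prodComm_apply, Prod.swap_prod_mk, blockDiagonal_apply, Matrix.smul_apply,
    smul_eq_mul]
  by_cases hij : i = j
  · subst hij
    simp
  · simp [hij]

/-- ★ **`det(diag(d) ⊕ T) = ∏_i det(d_i·1 + T)`** (block diagonal structure).
[cite: Bernstein2009, Prop. 7.2.3 (7.2.3)] -/
theorem det_kroneckerSum_diagonal (d : m → R) (T : Matrix n n R) :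
    (kroneckerSum (diagonal d) T).det = ∏ i, (d i • (1 : Matrix n n R) + T).det := by
  rw [diagonal_kroneckerSum_eq_reindex_blockDiagonal, det_reindex_self, det_blockDiagonal]

/-- Conjugating the first summand conjugates the Kronecker sum: for `C C' = 1`,
`(C D C') ⊕ T = (C ⊗ 1)(D ⊕ T)(C' ⊗ 1)`. [cite: Bernstein2009, Def. 7.2.1 (7.2.1); proof of Prop. 7.2.3] -/
theorem kroneckerSum_conj (C C' D : Matrix m m R) (hCC' : C * C' = 1) (T : Matrix n n R) :
    kroneckerSum (C * D * C') T =
      C ⊗ₖ (1 : Matrix n n R) * kroneckerSum D T * C' ⊗ₖ (1 : Matrix n n R) := by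
  simp only [kroneckerSum, Matrix.mul_add, Matrix.add_mul, ← mul_kronecker_mul, Matrix.mul_one,
    Matrix.one_mul, hCC']

/-- ★ The determinant of a Kronecker sum is unchanged under conjugation of the first summand:
`det((C D C') ⊕ T) = det(D ⊕ T)` for `C C' = 1`. [cite: Bernstein2009, Prop. 7.2.3 (7.2.3)] -/
theorem det_kroneckerSum_conj (C C' D : Matrix m m R) (hCC' : C * C' = 1) (T : Matrix n n R) :
    (kroneckerSum (C * D * C') T).det = (kroneckerSum D T).det := by
  rw [kroneckerSum_conj C C' D hCC' T, det_mul, det_mul]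
  have h1 : (C ⊗ₖ (1 : Matrix n n R)).det * (C' ⊗ₖ (1 : Matrix n n R)).det = 1 := by
    rw [← det_mul, ← mul_kronecker_mul, hCC', Matrix.mul_one, one_kronecker_one, det_one]
  calc (C ⊗ₖ (1 : Matrix n n R)).det * (kroneckerSum D T).det * (C' ⊗ₖ (1 : Matrix n n R)).det
      = (kroneckerSum D T).det * ((C ⊗ₖ (1 : Matrix n n R)).det * (C' ⊗ₖ (1 : Matrix n n R)).det) := by ring
    _ = (kroneckerSum D T).det := by rw [h1, mul_one]

omit [Fintype n] in
/-- `c·1 + diag(v) = diag(c + v)`. [cite: Bernstein2009, Def. 7.2.1] -/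
theorem smul_one_add_diagonal (c : R) (v : n → R) :
    c • (1 : Matrix n n R) + diagonal v = diagonal fun j => c + v j := by
  ext i j
  by_cases hij : i = j
  · subst hij
    simp
  · simp [hij]

end CommRing

/-! ## §2 Hermitian first summand: `det(S ⊕ T) = ∏_{λ ∈ spec S} det(λ·1 + T)` -/

section Hermitian

variable {𝕜 : Type*} [RCLike 𝕜]

/-- The spectral theorem in the shape used here: `S = U · diag(λ) · U⋆` with `U U⋆ = 1`.
[cite: Bernstein2009, Cor. 5.4.5 (unitary diagonalisation of a Hermitian matrix)] -/
theorem exists_eq_conj_diagonal_of_isHermitian {S : Matrix m m 𝕜} (hS : S.IsHermitian) :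
    ∃ U : Matrix m m 𝕜, U * star U = 1 ∧ S = U * diagonal (fun i => (hS.eigenvalues i : 𝕜)) * star U := by
  have hS' := hS.spectral_theorem
  rw [Unitary.conjStarAlgAut_apply] at hS'
  simp only [Function.comp_def] at hS'
  exact ⟨_, Unitary.coe_mul_star_self hS.eigenvectorUnitary, hS'⟩

/-- ★★ **The determinant of a Kronecker sum factorises over the spectrum of a Hermitian first summand**:
`det(S ⊗ 1 + 1 ⊗ T) = ∏_i det(λ_i·1 + T)`, `λ = hS.eigenvalues` (unitary diagonalisation `S = U diag(λ) U⋆`, then §1).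
[cite: Bernstein2009, Prop. 7.2.3 (7.2.3) (PDF p. 430)] -/
theorem det_kroneckerSum_of_isHermitian {S : Matrix m m 𝕜} (hS : S.IsHermitian) (T : Matrix n n 𝕜) :
    (kroneckerSum S T).det = ∏ i, ((hS.eigenvalues i : 𝕜) • (1 : Matrix n n 𝕜) + T).det := by
  obtain ⟨U, hUU, hS'⟩ := exists_eq_conj_diagonal_of_isHermitian hS
  have key := det_kroneckerSum_conj U (star U) (diagonal fun i => (hS.eigenvalues i : 𝕜)) hUU T
  rw [← hS', det_kroneckerSum_diagonal] at key
  exact key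

/-- `det(c·1 + T) = ∏_j (c + μ_j)` for `T` Hermitian, `μ = hT.eigenvalues`. [cite: Bernstein2009, Prop. 7.2.3 (7.2.3)] -/
theorem det_smul_one_add_of_isHermitian {T : Matrix n n 𝕜} (hT : T.IsHermitian) (c : 𝕜) :
    (c • (1 : Matrix n n 𝕜) + T).det = ∏ j, (c + (hT.eigenvalues j : 𝕜)) := by
  obtain ⟨U, hUU, hT'⟩ := exists_eq_conj_diagonal_of_isHermitian hT
  have h1 : c • (1 : Matrix n n 𝕜) + T = U * diagonal (fun j => c + (hT.eigenvalues j : 𝕜)) * star U := by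
    rw [← smul_one_add_diagonal, Matrix.mul_add, Matrix.add_mul, Matrix.mul_smul, Matrix.smul_mul, Matrix.mul_one,
      hUU, ← hT']
  have h2 : U.det * (star U).det = 1 := by rw [← det_mul, hUU, det_one]
  rw [h1, det_mul, det_mul, det_diagonal]
  calc U.det * (∏ j, (c + (hT.eigenvalues j : 𝕜))) * (star U).det
      = (∏ j, (c + (hT.eigenvalues j : 𝕜))) * (U.det * (star U).det) := by ring
    _ = _ := by rw [h2, mul_one]

/-- **Bernstein's Prop. 7.2.3 in determinant form**: for Hermitian `S`, `T`,
`det(S ⊗ 1 + 1 ⊗ T) = ∏_i ∏_j (λ_i + μ_j)`. [cite: Bernstein2009, Prop. 7.2.3 (7.2.3) (PDF p. 430)] -/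
theorem det_kroneckerSum_of_isHermitian_of_isHermitian {S : Matrix m m 𝕜} (hS : S.IsHermitian)
    {T : Matrix n n 𝕜} (hT : T.IsHermitian) :
    (kroneckerSum S T).det = ∏ i, ∏ j, ((hS.eigenvalues i : 𝕜) + (hT.eigenvalues j : 𝕜)) := by
  rw [det_kroneckerSum_of_isHermitian hS]
  exact Finset.prod_congr rfl fun i _ => det_smul_one_add_of_isHermitian hT _

end Hermitian

/-! ## §3 The periodic second difference (the «time circle») -/

section Circle

/-- The cycle Laplace eigenvalue in the `sin²` form: `2 − 2cos(2πk∕N) = 4 sin²(πk∕N)`.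
[cite: BrouwerHaemers2012, §1.4.3] -/
theorem cycleLapEig_eq_four_sin_sq (N : ℕ) (k : Fin N) :
    cycleLapEig N k = 4 * Real.sin (Real.pi * k / N) ^ 2 := by
  rw [cycleLapEig, cycleAngle, ← DiscretePoisson.four_sin_sq_half]
  have h : 2 * Real.pi * ((k.val : ℕ) : ℝ) / (N : ℝ) / 2 = Real.pi * ((k.val : ℕ) : ℝ) / (N : ℝ) := by ring
  rw [h]

variable {t : ℕ} [NeZero t]

/-- `z·1 + circulant v = circulant (δ₀ z + v)`. [cite: GolubVanLoan2013, §4.8.2 (circulant matrices)] -/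
theorem smul_one_add_circulant {R : Type*} [CommRing R] (z : R) (v : Fin t → R) :
    z • (1 : Matrix (Fin t) (Fin t) R) + circulant v = circulant (Pi.single 0 z + v) := by
  ext i j
  by_cases hij : i = j
  · subst hij
    simp
  · simp [hij, sub_eq_zero]

/-- ★ **The time-circle determinant over `ℂ`**: `det(z·1 + Δ_t) = ∏_k (z + (2 − 2cos(2πk∕t)))`, `Δ_t` the periodic
second difference `circulant (cycleLapVec ℂ t)` on `Fin t` (the DFT diagonalises circulants).
[cite: GolubVanLoan2013, Thm 4.8.2] [cite: BrouwerHaemers2012, §1.4.3] -/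
theorem det_smul_one_add_cycleLaplacian (z : ℂ) :
    (z • (1 : Matrix (Fin t) (Fin t) ℂ) + circulant (cycleLapVec ℂ t)).det = ∏ k : Fin t, (z + (cycleLapEig t k : ℂ)) := by
  obtain ⟨n, hn⟩ := Nat.exists_eq_add_one_of_ne_zero (NeZero.ne t)
  subst hn
  rw [smul_one_add_circulant, det_circulant_eq_prod_circulantEig]
  refine Finset.prod_congr rfl fun k _ => ?_
  rw [circulantEig_add, circulantEig_single, circulantEig_cycleLapVec, Fin.val_zero, pow_zero, inv_one, mul_one]

omit [NeZero t] in
/-- The Laplace column `(2, −1, 0, …, 0, −1)` of the cycle is the same vector over `ℝ` and over `ℂ`.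
[cite: BrouwerHaemers2012, §1.4.3] -/
private theorem ofReal_cycleLapVec [NeZero t] (d : Fin t) : ((cycleLapVec ℝ t d : ℝ) : ℂ) = cycleLapVec ℂ t d := by
  simp only [cycleLapVec, cycleAdjVec, Pi.sub_apply, Pi.add_apply, Pi.single_apply]
  split_ifs <;> simp

/-- The real periodic second difference complexifies to the complex one. [cite: GolubVanLoan2013, §4.8.2] -/
theorem map_smul_one_add_cycleLaplacian (lam : ℝ) :
    (lam • (1 : Matrix (Fin t) (Fin t) ℝ) + circulant (cycleLapVec ℝ t)).map (algebraMap ℝ ℂ) =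
      (lam : ℂ) • (1 : Matrix (Fin t) (Fin t) ℂ) + circulant (cycleLapVec ℂ t) := by
  ext i j
  simp only [Matrix.map_apply, Matrix.add_apply, Matrix.smul_apply, circulant_apply, smul_eq_mul,
    Complex.coe_algebraMap, Complex.ofReal_add, Complex.ofReal_mul, ofReal_cycleLapVec]
  by_cases hij : i = j
  · subst hij
    simp
  · simp [hij]

/-- ★ **The time-circle determinant over `ℝ`**: `det(λ·1 + Δ_t) = ∏_{q<t} (λ + 4 sin²(πq∕t))`.
[cite: GolubVanLoan2013, Thm 4.8.2] [cite: BrouwerHaemers2012, §1.4.3] -/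
theorem det_smul_one_add_cycleLaplacian_real (lam : ℝ) :
    (lam • (1 : Matrix (Fin t) (Fin t) ℝ) + circulant (cycleLapVec ℝ t)).det =
      ∏ q ∈ Finset.range t, (lam + 4 * Real.sin (Real.pi * q / t) ^ 2) := by
  apply Complex.ofReal_injective
  have h1 := RingHom.map_det (algebraMap ℝ ℂ) (lam • (1 : Matrix (Fin t) (Fin t) ℝ) + circulant (cycleLapVec ℝ t))
  rw [RingHom.mapMatrix_apply, map_smul_one_add_cycleLaplacian, det_smul_one_add_cycleLaplacian] at h1
  simp only [Complex.coe_algebraMap] at h1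
  rw [h1, Complex.ofReal_prod, Finset.prod_range]
  refine Finset.prod_congr rfl fun k _ => ?_
  rw [cycleLapEig_eq_four_sin_sq]
  push_cast
  ring

/-- The closed form of the time-circle determinant: for `λ ≥ 0`,
`det(λ·1 + Δ_t) = 4 sinh²(tω∕2)` with `ω = 2 arsinh(√λ∕2)` (i.e. `cosh ω = 1 + λ∕2`; `= 2cosh(tω) − 2`).
[cite: GolubVanLoan2013, Thm 4.8.2] [cite: BrouwerHaemers2012, §1.4.3] -/
theorem det_smul_one_add_cycleLaplacian_eq_sinh_sq {lam : ℝ} (hlam : 0 ≤ lam) :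
    (lam • (1 : Matrix (Fin t) (Fin t) ℝ) + circulant (cycleLapVec ℝ t)).det =
      4 * Real.sinh (t * (2 * Real.arsinh (Real.sqrt lam / 2)) / 2) ^ 2 := by
  rw [det_smul_one_add_cycleLaplacian_real,
    Literature.Analysis.SpecialFunctions.prod_add_four_sin_sq_of_nonneg (Nat.pos_of_ne_zero (NeZero.ne t)) hlam]

/-- ★★ **Spatial ⊕ time-circle**: for a real symmetric `S` (eigenvalues `λ_i`) and the periodic second difference
`Δ_t` on `Fin t`, `det(S ⊗ 1 + 1 ⊗ Δ_t) = ∏_i ∏_{q<t} (λ_i + 4 sin²(πq∕t))` — the Gaussian determinant of a slab operator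
factorises over the spatial spectrum into time-circle factors. [cite: Bernstein2009, Prop. 7.2.3 (7.2.3)]
[cite: GolubVanLoan2013, Thm 4.8.2] [cite: BrouwerHaemers2012, §1.4.3] -/
theorem det_kroneckerSum_cycleLaplacian_of_isHermitian {S : Matrix m m ℝ} (hS : S.IsHermitian) :
    (kroneckerSum S (circulant (cycleLapVec ℝ t))).det =
      ∏ i, ∏ q ∈ Finset.range t, (hS.eigenvalues i + 4 * Real.sin (Real.pi * q / t) ^ 2) := by
  rw [det_kroneckerSum_of_isHermitian hS]
  refine Finset.prod_congr rfl fun i _ => ?_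
  rw [← det_smul_one_add_cycleLaplacian_real]
  rfl

/-- ★★ … and its closed form: `det(S ⊗ 1 + 1 ⊗ Δ_t) = ∏_i 4 sinh²(tω_i∕2)`, `ω_i = 2 arsinh(√λ_i∕2)`, for a real symmetric
positive semidefinite `S`. [cite: Bernstein2009, Prop. 7.2.3 (7.2.3)] [cite: GolubVanLoan2013, Thm 4.8.2] -/
theorem det_kroneckerSum_cycleLaplacian_eq_prod_sinh_sq {S : Matrix m m ℝ} (hS : S.PosSemidef) :
    (kroneckerSum S (circulant (cycleLapVec ℝ t))).det =
      ∏ i, 4 * Real.sinh (t * (2 * Real.arsinh (Real.sqrt (hS.1.eigenvalues i) / 2)) / 2) ^ 2 := by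
  rw [det_kroneckerSum_of_isHermitian hS.1]
  refine Finset.prod_congr rfl fun i _ => ?_
  rw [← det_smul_one_add_cycleLaplacian_eq_sinh_sq (hS.eigenvalues_nonneg i)]
  rfl

end Circle

/-! ## §4 Doubling the time circle: `det(λ·1 + Δ_t)² ∕ det(λ·1 + Δ_{2t}) = tanh²(tω∕2)` -/

section Doubling

/-- `4 sinh²(y∕2) = 2cosh y − 2` (the closed form of §3 in the `2cosh(tω) − 2` normalisation).
[cite: GolubVanLoan2013, Thm 4.8.2] -/
theorem four_sinh_sq_half (y : ℝ) : 4 * Real.sinh (y / 2) ^ 2 = 2 * Real.cosh y - 2 := by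
  have h := Real.cosh_two_mul (y / 2)
  rw [show 2 * (y / 2) = y by ring, Real.cosh_sq] at h
  linarith

/-- `(4 sinh² x)² ∕ (4 sinh²(2x)) = tanh² x` (also at `x = 0`, where both sides are `0` with `0 ∕ 0 = 0`).
[cite: GolubVanLoan2013, Thm 4.8.2] -/
theorem sq_four_sinh_sq_div (x : ℝ) :
    (4 * Real.sinh x ^ 2) ^ 2 / (4 * Real.sinh (2 * x) ^ 2) = Real.tanh x ^ 2 := by
  rw [Real.tanh_eq_sinh_div_cosh, Real.sinh_two_mul]
  have hc : Real.cosh x ≠ 0 := (Real.cosh_pos x).ne'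
  by_cases hs : Real.sinh x = 0
  · simp [hs]
  · field_simp
    ring

variable {t t₂ : ℕ} [NeZero t] [NeZero t₂]

/-- The time-circle determinant in the `2cosh − 2` normalisation: for `λ ≥ 0`, `det(λ·1 + Δ_t) = 2cosh(tω) − 2`,
`ω = 2 arsinh(√λ∕2)` (so `cosh ω = 1 + λ∕2`, `CircleLaplacianDeterminant.cosh_two_arsinh_sqrt_div_two`).
[cite: GolubVanLoan2013, Thm 4.8.2] [cite: BrouwerHaemers2012, §1.4.3] -/
theorem det_smul_one_add_cycleLaplacian_eq_two_cosh_sub {lam : ℝ} (hlam : 0 ≤ lam) :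
    (lam • (1 : Matrix (Fin t) (Fin t) ℝ) + circulant (cycleLapVec ℝ t)).det =
      2 * Real.cosh (t * (2 * Real.arsinh (Real.sqrt lam / 2))) - 2 := by
  rw [det_smul_one_add_cycleLaplacian_eq_sinh_sq hlam, four_sinh_sq_half]

/-- ★ **Doubling the time circle**: for `λ ≥ 0` and `t₂ = 2t`,
`det(λ·1 + Δ_t)² ∕ det(λ·1 + Δ_{t₂}) = tanh²(tω∕2)`, `ω = 2 arsinh(√λ∕2)`.
[cite: GolubVanLoan2013, Thm 4.8.2] [cite: BrouwerHaemers2012, §1.4.3] -/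
theorem det_smul_one_add_cycleLaplacian_sq_div {lam : ℝ} (hlam : 0 ≤ lam) (h2 : t₂ = 2 * t) :
    (lam • (1 : Matrix (Fin t) (Fin t) ℝ) + circulant (cycleLapVec ℝ t)).det ^ 2 /
        (lam • (1 : Matrix (Fin t₂) (Fin t₂) ℝ) + circulant (cycleLapVec ℝ t₂)).det =
      Real.tanh (t * (2 * Real.arsinh (Real.sqrt lam / 2)) / 2) ^ 2 := by
  rw [det_smul_one_add_cycleLaplacian_eq_sinh_sq hlam, det_smul_one_add_cycleLaplacian_eq_sinh_sq hlam, h2,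
    Nat.cast_mul, Nat.cast_two, ← sq_four_sinh_sq_div]
  congr 3
  ring

/-- ★★ **Doubling the time circle under a spatial operator**: for a real symmetric positive semidefinite `S`
(eigenvalues `λ_i`, `ω_i = 2 arsinh(√λ_i∕2)`) and `t₂ = 2t`,
`det(S ⊗ 1 + 1 ⊗ Δ_t)² ∕ det(S ⊗ 1 + 1 ⊗ Δ_{t₂}) = ∏_i tanh²(tω_i∕2)`.
[cite: Bernstein2009, Prop. 7.2.3 (7.2.3)] [cite: GolubVanLoan2013, Thm 4.8.2] -/
theorem det_kroneckerSum_cycleLaplacian_sq_div {S : Matrix m m ℝ} (hS : S.PosSemidef) (h2 : t₂ = 2 * t) :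
    (kroneckerSum S (circulant (cycleLapVec ℝ t))).det ^ 2 /
        (kroneckerSum S (circulant (cycleLapVec ℝ t₂))).det =
      ∏ i, Real.tanh (t * (2 * Real.arsinh (Real.sqrt (hS.1.eigenvalues i) / 2)) / 2) ^ 2 := by
  rw [det_kroneckerSum_of_isHermitian hS.1, det_kroneckerSum_of_isHermitian hS.1, ← Finset.prod_pow,
    ← Finset.prod_div_distrib]
  refine Finset.prod_congr rfl fun i _ => ?_
  exact det_smul_one_add_cycleLaplacian_sq_div (hS.eigenvalues_nonneg i) h2

end Doubling

end Literature.Analysis.Matrix.KroneckerSumDeterminant
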